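import Summits.QuantumFields.YangMills.Theses.SamplerStability
import Summits.QuantumFields.YangMills.Theorems.SamplerStabilityUnitSamplerGapPerturbedEfronStein

/-!
# Route `SamplerStability`, crux `UnitSamplerGap` (stmt-QuantumFields-28042), LINE 11 «holley_stroock»:
# the registered stub `stub_perturbedEfronStein` BY NAME AND SIGNATURE

This file reproduces the registered birth skeleton's declarations VERBATIM (skeleton sha256 8be04446…, planner
ym-idea-5 g9: `G2`, `avSU`, `X0`, `rho`, `pi0`, `envSigma`, `hbEnergy`, `var`, the three node Props and the
`__Registered.*` aliases), so that `__Registered.stub_perturbedEfronStein` IS the registered Prop, and proves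

  `theorem stub_perturbedEfronStein : __Registered.stub_perturbedEfronStein`

— STUB 2 (M): for every probability measure `μ = u · π₀` on `X₀ = SU(2)^{unit bonds}` with `u` measurable and
`e^{-b} ≤ u ≤ e^{b}` and every `g ∈ L²(μ)`, `Var_μ(g) ≤ e^{2b} · Σ_e (∫ g² dμ − ∫ (E_μ[g | links ≠ e])² dμ)`.
It is the lattice instance (`π₀ = fieldMeasure = Measure.pi (fun _ => Haar)`, by definition) of the route-independent
`Theorems.UnitSamplerGap.var_le_exp_mul_sum` (Efron–Stein for product Haar in conditional form + Holley–Stroock, factor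
`e^{b}` twice; helpers `SamplerStabilityUnitSamplerGapEfronStein`, `SamplerStabilityUnitSamplerGapPerturbedEfronStein`).
Also recorded: the skeleton's kernel-checked composition `UnitSamplerGap_of` (verbatim) and its corollary
`unitSamplerGap_of_haarSandwich` — the crux now rests on exactly ONE registered stub, `stub_haarSandwich` (XL, the
two-sided cut-off-uniform Haar sandwich of the renormalised unit density).

Cell `ym-idea-1` width seat `ym-line-sfw-p2-w3` g29 (free hands), endorsed order of critic idea-crit-5 NOTE #165 /
planner ym-idea-5 g15 LANDABLE-NOW-g15 §4.5.  HONEST FRAMING: `stub_haarSandwich` (XL, load-bearing) and the rung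
`stub_fixedCutoffGap` are NOT proved here; no crux, route, rung or summit is proved; the YM mass gap is NOT proved.
-/

noncomputable section

namespace Summit.QuantumFields.YangMills.Cruxes.UnitSamplerGap.HolleyStroock

open scoped BigOperators Topology Classical MeasureTheory ProbabilityTheory NNReal ENNReal
open Filter Set Function MeasureTheory
open Literature.MathematicalPhysics.QuantumFieldTheory
open Literature.MathematicalPhysics.QuantumFieldTheory.Balaban1983to89

/-- The gauge group `SU(2)`. -/
abbrev G2 : Type := Matrix.specialUnitaryGroup (Fin 2) ℂ

/-- Bałaban's small-loop average used by the leaf. -/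
noncomputable abbrev avSU : LoopAverage G2 := ExpMeanLog.expMeanLogSU

variable (F : T3ContinuumYM3Torus.T3Family)

/-- The fixed unit-lattice configuration space `X₀ = SU(2)^{unit bonds}`. -/
abbrev X0 : Type := GaugeField (F.P 0) 0 G2

/-- The renormalised unit law `ρ_K` at parameter `γ`. -/
noncomputable abbrev rho (γ : ℝ) (K : ℕ) : Measure (X0 F) :=
  F.unitLaw avSU T4ApexTwoLevel.measurableE_expMeanLogSU γ K

/-- Normalised product Haar measure `π₀` on `X₀`. -/
noncomputable abbrev pi0 : Measure (X0 F) := fieldMeasure (F.P 0) 0 G2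

/-- The σ-algebra generated by all unit links except `e`. -/
noncomputable abbrev envSigma (e : PBond (F.P 0) 0) : MeasurableSpace (X0 F) :=
  MeasurableSpace.comap (fun (W : X0 F) (b : {b : PBond (F.P 0) 0 // b ≠ e}) => W b.1) MeasurableSpace.pi

/-- The single-link heat-bath Dirichlet energy `Σ_e (∫ g² dμ − ∫ (E_μ[g | links ≠ e])² dμ)`. -/
noncomputable abbrev hbEnergy (μ : Measure (X0 F)) (g : X0 F → ℝ) : ℝ :=
  ∑ e : PBond (F.P 0) 0, ((∫ V, g V ^ 2 ∂μ) - ∫ V, (condExp (envSigma F e) μ g V) ^ 2 ∂μ)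

/-- The variance `∫ g² dμ − (∫ g dμ)²`. -/
noncomputable abbrev var (μ : Measure (X0 F)) (g : X0 F → ℝ) : ℝ :=
  (∫ V, g V ^ 2 ∂μ) - (∫ V, g V ∂μ) ^ 2

/-! ## Stubs -/

/-- STUB 1 (XL, hardest, load-bearing). TWO-SIDED UV STABILITY OF THE FULL RENORMALISED UNIT DENSITY w.r.t. product Haar,
uniformly in the cut-off, large unit fields included. -/
def HaarSandwich : Prop :=
  ∃ γ₁ : ℝ, 0 < γ₁ ∧ ∀ (F : T3ContinuumYM3Torus.T3Family) (γ : ℝ), 0 < γ → γ ≤ γ₁ →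
    ∃ (b : ℝ) (K₀ : ℕ), ∀ K : ℕ, K₀ ≤ K →
      ∃ u : X0 F → ℝ, Measurable u ∧ (∀ V, Real.exp (-b) ≤ u V ∧ u V ≤ Real.exp b) ∧
        rho F γ K = (pi0 F).withDensity (fun V => ENNReal.ofReal (u V))

/-- STUB 2 (M, provable). EFRON–STEIN FOR PRODUCT HAAR + HOLLEY–STROOCK COMPARISON: the heat-bath Poincaré inequality for every
probability measure with a two-sided bounded density w.r.t. `π₀`, constant `e^{2b}`. -/
def PerturbedEfronStein : Prop :=
  ∀ (F : T3ContinuumYM3Torus.T3Family) (μ : Measure (X0 F)), IsProbabilityMeasure μ →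
    ∀ (b : ℝ) (u : X0 F → ℝ), Measurable u → (∀ V, Real.exp (-b) ≤ u V ∧ u V ≤ Real.exp b) →
      μ = (pi0 F).withDensity (fun V => ENNReal.ofReal (u V)) →
      ∀ g : X0 F → ℝ, MemLp g 2 μ → var F μ g ≤ Real.exp (2 * b) * hbEnergy F μ g

/-- STUB 3 (L, BC5 plan-only rung; not used in `_of`). THE SAMPLER GAP AT ONE FIXED CUT-OFF (no uniformity in `K`). -/
def FixedCutoffGap : Prop :=
  ∀ (F : T3ContinuumYM3Torus.T3Family) (γ : ℝ), 0 < γ → ∀ K : ℕ,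
    ∃ C : ℝ, 0 < C ∧ ∀ g : X0 F → ℝ, MemLp g 2 (rho F γ K) → var F (rho F γ K) g ≤ C * hbEnergy F (rho F γ K) g

namespace __Registered
/-- registered stub alias -/ abbrev stub_haarSandwich : Prop := HaarSandwich
/-- registered stub alias -/ abbrev stub_perturbedEfronStein : Prop := PerturbedEfronStein
/-- registered stub alias -/ abbrev stub_fixedCutoffGap : Prop := FixedCutoffGap
end __Registered

/-! ## The registered stub `stub_perturbedEfronStein`, by name -/

/-- **STUB 2 of LINE 11 «holley_stroock»** (registered alias, statement verbatim): Efron–Stein for product Haar +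
Holley–Stroock comparison — the single-link heat-bath Poincaré inequality with constant `e^{2b}` for every probability
measure with a two-sided bounded density w.r.t. `π₀`.  The lattice instance of
`Theorems.UnitSamplerGap.var_le_exp_mul_sum` with `ρ = Haar` on `SU(2)`. [cite: BoucheronBousquetLugosi2004, §2 Thm 4]
[cite: HolleyStroock1987, Lemma (bounded perturbation)] -/
theorem stub_perturbedEfronStein : __Registered.stub_perturbedEfronStein := by
  intro F μ hμ b u hu hbd hρ g hg
  exact @Summit.QuantumFields.YangMills.Theorems.UnitSamplerGap.var_le_exp_mul_sum (PBond (F.P 0) 0) _ G2 _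
    (HaarData.haar : Measure G2) _ μ hμ b u hu hbd hρ g hg

/-- De-vacuity check (skeleton, verbatim): the environment σ-algebra IS a sub-σ-algebra (so `condExp` is the genuine one,
not the junk `0`). -/
theorem envSigma_le (e : PBond (F.P 0) 0) : envSigma F e ≤ (inferInstance : MeasurableSpace (X0 F)) := by
  apply Measurable.comap_le
  exact measurable_pi_lambda _ (fun b => measurable_pi_apply _)

/-! ## Composition (kernel-checked) -/

/-- The two stubs imply the crux `UnitSamplerGap` BY NAME. -/
theorem UnitSamplerGap_of (hA : __Registered.stub_haarSandwich) (hB : __Registered.stub_perturbedEfronStein) :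
    Summit.QuantumFields.YangMills.Theses.SamplerStability.UnitSamplerGap := by
  obtain ⟨γ₁, hγ₁, h⟩ := hA
  refine ⟨γ₁, hγ₁, fun F γ hγ hle => ?_⟩
  obtain ⟨b, K₀, hK⟩ := h F γ hγ hle
  refine ⟨Real.exp (2 * b), K₀, Real.exp_pos _, fun K hKle g hg => ?_⟩
  obtain ⟨u, hu, hbd, hρ⟩ := hK K hKle
  have hP : IsProbabilityMeasure (rho F γ K) :=
    T3ThresholdRemoval.isProbabilityMeasure_unitLaw T4ApexTwoLevel.measurableE_expMeanLogSU hγ.le K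
  exact hB F (rho F γ K) hP b u hu hbd hρ g hg


/-- **The crux modulo its one remaining stub**: `UnitSamplerGap` follows from `stub_haarSandwich` alone
(composition `UnitSamplerGap_of` with the landed `stub_perturbedEfronStein`). -/
theorem unitSamplerGap_of_haarSandwich (hA : __Registered.stub_haarSandwich) :
    Summit.QuantumFields.YangMills.Theses.SamplerStability.UnitSamplerGap :=
  UnitSamplerGap_of hA stub_perturbedEfronStein

end Summit.QuantumFields.YangMills.Cruxes.UnitSamplerGap.HolleyStroock
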